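import Summits.HodgeConjecture.HodgeConjecture.Theorems.MarkmanPartnerTransportPartnerExistenceLatticeTransc
import Summits.HodgeConjecture.HodgeConjecture.Theorems.NikulinTwinTransportSquareGlueFreeNeronSeveri
import Literature.AlgebraicGeometry.Surfaces.GeometricGenusOneAssociatedK3Surface
import Literature.AlgebraicGeometry.Surfaces.K3TranscendentalLatticeSignatureHolds

/-!
# Route MarkmanPartnerTransport · support `PartnerExistence` / crux #5 — the partner's Picard number from
# below: `ρ(S) + 1 ≤ ρ(X)` (so `ρ(S) = ρ(X) − 1` for every K3 partner)

Companion to `…PartnerTransportPicardRank` (`ρ(X) ≤ ρ(S) + 1` along a partner realised on a marked Hilbert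
square) and to X3a (`…PartnerOfMinusTwoClass`: partners with `ρ(X) ≤ ρ(S) + 1`). The OTHER inequality is
elementary dimension counting and needs only the route's surjectivity clause (g6) of the partner map:

* §1 `algebraicClasses_inf_transcendentalSubspace_eq_bot` — `N¹H²(S) ∩ T(S) = 0` on a smooth projective surface
  (Hodge index: `exists_neronSeveri_gramBasis`); `finrank_algebraicClasses_add_finrank_transcendentalSubspace_le` —
  `ρ(S) + dim T(S) ≤ 22` for a marked K3 surface;
* §2 **`finrank_algebraicClasses_succ_le_of_partner`** — for a marked smooth projective fourfold `(X, φ, P, z)`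
  and `g : H²(S) → H²(X)` mapping the cup-transcendental classes of the K3 surface `S` ONTO the
  `q`-transcendental classes of `X` ((g6)), **`ρ(S) + 1 ≤ ρ(X)`** (`dim T(S) ≥ dim T(X)_ℂ = 23 − ρ(X)`,
  `finrank_ratTransc` ∕ `mem_span_ratTransc_iff`).

Use: the rung «PARTNERED `ρ = 3`» then needs HC⁴ of K3 squares at Picard number EXACTLY `2`
(`…PicardThreePartnered`). No definition, no sorry, no named fact. Prover seat hodge-nonav-19716-p2 (gen 4),
`--supports stmt-HodgeConjecture-19653`.

References: D. Huybrechts, *Lectures on K3 Surfaces*, Ch. 1 Prop. 3.5, Ch. 3 Lemma 3.1; C. Voisin, *Hodge Theory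
I*, Thm. 6.32; A. Beauville, J. Differential Geom. 18 (1983) §8–9.
-/

noncomputable section

set_option linter.dupNamespace false

open Module CategoryTheory
open Literature.AlgebraicTopology.SingularHomology Literature.Geometry.Kaehler
open Literature.AlgebraicGeometry Literature.AlgebraicGeometry.Motives Literature.AlgebraicGeometry.HodgeTheory
open Literature.AlgebraicGeometry.Hyperkaehler Literature.AlgebraicGeometry.Surfaces
open Summit.HodgeConjecture.HodgeConjecture.Theorems.NikulinTwinTransport
open Summit.HodgeConjecture.HodgeConjecture.Theorems.NikulinTwinTransport.SquareGlueFree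
open Summit.HodgeConjecture.HodgeConjecture.Theorems.MarkmanPartnerTransport.BBFPositivity

namespace Summit.HodgeConjecture.HodgeConjecture.Theorems.MarkmanPartnerTransport.PartnerLattice

/-- `MarkedK3Sq[X, φ, P, z]`: VERBATIM the `let MarkedK3Sq := …` binder of the route declarations of
MarkmanPartnerTransport (clauses (m1)–(m6)). Local notation only. -/
local notation3 (prettyPrint := false) "MarkedK3Sq[" X ", " φ ", " P ", " z "]" =>
  (((IsIntegralClass P ∧ ∀ Q : complexBetti X (2 * 4), IsIntegralClass Q → ∃ n : ℤ, Q = n • P) ∧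
    (∀ c : complexBetti X 2, IsIntegralClass c ↔ ∃ v : K3HilbertIndex → ℤ, φ c = fun i => (v i : ℂ)) ∧
    (∀ a : complexBetti X 2, cupPowTwo a 4 = ((3 : ℂ) * (k3HilbertForm 2 (φ a) (φ a)) ^ 2) • P) ∧
    (IsOfHodgeType 4 X 2 2 0 (LinearEquiv.symm φ z) ∧
      ∀ τ : complexBetti X 2, IsOfHodgeType 4 X 2 2 0 τ → ∃ t : ℂ, τ = t • LinearEquiv.symm φ z) ∧
    (∀ c : complexBetti X 2, IsOfHodgeType 4 X 2 1 1 c ↔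
      (k3HilbertForm 2 (φ c) z = 0 ∧ k3HilbertForm 2 (φ c) (star z) = 0)) ∧
    (k3HilbertForm 2 z z = 0 ∧ 0 < (k3HilbertForm 2 (star z) z).re)))

/-- `qQ` = the rational Beauville–Bogomolov form of `K3^{[2]}`-type on `ℚ²³`. Local notation only. -/
local notation3 (prettyPrint := false) "qQ" => Matrix.toBilin' (Matrix.map (k3HilbertGram 2) (Int.cast : ℤ → ℚ))

variable {S : SchemeOver ℂ}

/-! ### §1 `N¹H²(S) ∩ T(S) = 0` on a smooth projective surface (Hodge index) -/

/-- **`N¹H²(S) ∩ T(S) = 0` for a smooth projective surface**: the cup form is non-degenerate on `N¹H²(S)`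
(a rational basis `dᵢ` with invertible Gram matrix, `exists_neronSeveri_gramBasis` — Hodge index), so an algebraic
class cup-orthogonal to all algebraic classes vanishes. [cite: VoisinHodgeI2002, Thm. 6.32 and Lemma 11.41]
[cite: Huybrechts2016K3, Ch. 3 Lemma 3.1] -/
theorem algebraicClasses_inf_transcendentalSubspace_eq_bot (hS : IsSmoothProjective 2 S) :
    algebraicClasses S 1 ⊓ transcendentalSubspace S = ⊥ := by
  classical
  obtain ⟨r, d, M, -, hdN, -, hspan, hGM, -⟩ := exists_neronSeveri_gramBasis hS
  rw [eq_bot_iff]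
  intro a ha
  obtain ⟨haN, haT⟩ := Submodule.mem_inf.1 ha
  rw [Submodule.mem_bot]
  rw [← hspan] at haN
  obtain ⟨c, rfl⟩ := (Submodule.mem_span_range_iff_exists_fun ℂ).1 haN
  rw [mem_transcendentalSubspace_iff_forall_algebraicClasses hS] at haT
  -- `Σᵢ cᵢ (dᵢ · dⱼ) = 0` for all `j`
  have hc : ∀ j, ∑ i, c i * traceC hS (cupProduct (rfl : 2 * 1 + 2 * 1 = 2 * 2) (d i) (d j)) = 0 := by
    intro j
    have h := congrArg (traceC hS) (haT (d j) (hdN j))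
    rw [map_zero, map_sum, LinearMap.sum_apply, map_sum] at h
    simpa only [map_smul, LinearMap.smul_apply, smul_eq_mul] using h
  -- multiply by the inverse Gram matrix: every `c k` vanishes
  have hck : ∀ k, c k = 0 := by
    intro k
    calc c k = ∑ i, c i * (if i = k then 1 else 0) := by
            rw [Finset.sum_eq_single k (fun i _ hik => by simp [hik]) (by simp)]; simp
      _ = ∑ i, c i * ∑ j, traceC hS (cupProduct (rfl : 2 * 1 + 2 * 1 = 2 * 2) (d i) (d j)) * ((M j k : ℚ) : ℂ) := by
            refine Finset.sum_congr rfl fun i _ => ?_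
            rw [hGM i k]
      _ = ∑ j, (∑ i, c i * traceC hS (cupProduct (rfl : 2 * 1 + 2 * 1 = 2 * 2) (d i) (d j))) * ((M j k : ℚ) : ℂ) := by
            simp only [Finset.mul_sum, Finset.sum_mul, mul_assoc]
            rw [Finset.sum_comm]
      _ = 0 := by simp [hc]
  simp [hck]

/-- **`ρ(S) + dim T(S) ≤ b₂(S)`**, here for a marked K3 surface: `ρ(S) + dim_ℂ T(S) ≤ 22`.
[cite: Huybrechts2016K3, Ch. 3 Lemma 3.1 and Ch. 1 Prop. 3.5] -/
theorem finrank_algebraicClasses_add_finrank_transcendentalSubspace_le (hS : IsK3Surface S)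
    (η : complexBetti S (2 * 1) ≃ₗ[ℂ] (K3Index → ℂ)) :
    finrank ℂ (algebraicClasses S 1) + finrank ℂ (transcendentalSubspace S) ≤ 22 := by
  haveI : Module.Finite ℂ (complexBetti S (2 * 1)) := finite_complexBetti hS.isSmoothProjective (2 * 1)
  rw [← Submodule.finrank_sup_add_finrank_inf_eq,
    algebraicClasses_inf_transcendentalSubspace_eq_bot hS.isSmoothProjective, finrank_bot, add_zero,
    ← finrank_complexBetti_two_of_marking η]
  exact Submodule.finrank_le _

/-! ### §2 `ρ(S) + 1 ≤ ρ(X)` along a partner -/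

variable {X : SchemeOver ℂ} {φ : complexBetti X 2 ≃ₗ[ℂ] (K3HilbertIndex → ℂ)} {P : complexBetti X (2 * 4)}
  {z : K3HilbertIndex → ℂ}

/-- **`ρ(S) + 1 ≤ ρ(X)` for every K3 partner mapping `T(S)` ONTO `T(X)_ℂ`.**  For a marked smooth projective
fourfold `(X, φ, P, z)`, a marked K3 surface `S` (any marking `η`, used only for `b₂(S) = 22`) and a linear
`g : H²(S) → H²(X)` with the route's surjectivity clause (g6) — every `q`-transcendental class of `X` is `g a`
for a cup-transcendental `a` — one has `dim T(S) ≥ dim T(X)_ℂ = 23 − ρ(X)` (`finrank_ratTransc`,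
`mem_span_ratTransc_iff`) and `ρ(S) + dim T(S) ≤ 22` (Hodge index), whence `ρ(S) + 1 ≤ ρ(X)`. With X3a's
`ρ(X) ≤ ρ(S) + 1` this pins the partner's Picard number: **`ρ(S) = ρ(X) − 1`**.
[cite: Beauville1983, §8–9] [cite: Huybrechts2016K3, Ch. 3 Lemma 3.1] -/
theorem finrank_algebraicClasses_succ_le_of_partner (hX : IsSmoothProjective 4 X) (hM : MarkedK3Sq[X, φ, P, z])
    (hS : IsK3Surface S) (η : complexBetti S (2 * 1) ≃ₗ[ℂ] (K3Index → ℂ))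
    {g : complexBetti S (2 * 1) →ₗ[ℂ] complexBetti X 2}
    (hg6 : ∀ y, (∀ d : complexBetti X 2, d ∈ algebraicClasses X 1 → k3HilbertForm 2 (φ y) (φ d) = 0) →
      ∃ a, (∀ d ∈ algebraicClasses S 1, cupProduct (rfl : 2 * 1 + 2 * 1 = 2 * 2) a d = 0) ∧ g a = y) :
    finrank ℂ (algebraicClasses S 1) + 1 ≤ finrank ℂ (algebraicClasses X 1) := by
  obtain ⟨-, hint, -⟩ := id hM
  haveI : Module.Finite ℂ (complexBetti S (2 * 1)) := finite_complexBetti hS.isSmoothProjective (2 * 1)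
  obtain ⟨NQ, hNQ⟩ := exists_ratNeronSeveri (X := X) φ
  -- `T(X)_ℂ` in the marking and its dimension `23 - ρ(X)`
  set TX : Submodule ℂ (K3HilbertIndex → ℂ) := Submodule.span ℂ
    ((fun a : K3HilbertIndex → ℚ => fun i => (a i : ℂ)) '' ((qQ).orthogonal NQ : Set (K3HilbertIndex → ℚ)))
    with hTXdef
  have hTX : finrank ℂ TX = 23 - finrank ℂ (algebraicClasses X 1) := by
    rw [hTXdef, finrank_span_ratCast, finrank_ratTransc hX hint hNQ]
  have hρX : finrank ℂ (algebraicClasses X 1) ≤ 23 := by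
    rw [← finrank_ratNeronSeveri hX hint hNQ, ← finrank_rat23]
    exact Submodule.finrank_le NQ
  -- `T(X)_ℂ ⊆ φ(g(T(S)))`
  have hle : TX ≤ (transcendentalSubspace S).map
      ((φ : complexBetti X 2 →ₗ[ℂ] (K3HilbertIndex → ℂ)) ∘ₗ g) := by
    intro v hv
    have hy : ∀ d : complexBetti X 2, d ∈ algebraicClasses X 1 → k3HilbertForm 2 (φ (φ.symm v)) (φ d) = 0 := by
      intro d hd
      rw [LinearEquiv.apply_symm_apply]
      exact (mem_span_ratTransc_iff hX hint hNQ v).1 hv d hd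
    obtain ⟨a, haT, hga⟩ := hg6 (φ.symm v) hy
    refine Submodule.mem_map.2 ⟨a, ?_, ?_⟩
    · exact (mem_transcendentalSubspace_iff_forall_algebraicClasses hS.isSmoothProjective a).2 haT
    · rw [LinearMap.comp_apply, LinearEquiv.coe_coe, hga, LinearEquiv.apply_symm_apply]
  have h1 : finrank ℂ TX ≤ finrank ℂ (transcendentalSubspace S) :=
    (Submodule.finrank_mono hle).trans (Submodule.finrank_map_le _ _)
  have h2 := finrank_algebraicClasses_add_finrank_transcendentalSubspace_le hS η
  omega

end Summit.HodgeConjecture.HodgeConjecture.Theorems.MarkmanPartnerTransport.PartnerLattice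

end
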